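import Summits.HubbardSuperconductivity.HubbardSuperconductivity.Theses.ThermalWedge
import Summits.HubbardSuperconductivity.HubbardSuperconductivity.Theorems.ThermalWedgeTwSourcedCondensationFreeLinearThermalLaw
import Literature.MathematicalPhysics.QuantumLattice.GibbsEntropy
import Literature.MathematicalPhysics.QuantumLattice.GibbsPressureTemperature
import Literature.MathematicalPhysics.QuantumLattice.DWaveSourceProofs

/-!
# Crux `TwSourcedInertness` (item `stmt-HubbardSuperconductivity-1696`), line
`temperature-for-source-exchange`: the heat-chord stub IS the interacting entropy-density law

`--supports stmt-HubbardSuperconductivity-1696` file (line lead; mathematics by the line's stub-worker);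
no definition is introduced. The registered stub `stub_thermalCorrection` of the line's skeleton
(Cruxes/TwSourcedInertness/Lines/temperature_for_source_exchange.lean) asks that the INTERACTION
CORRECTION to the dyadic heat chord of the grand-canonical pressure,
`[p_U(β/2) − p_U(β)] − [p_0(β/2) − p_0(β)]`, `p_U(β) = log Re Z_β(hubbardTorusWith 2 L 1 U μ)/(βL²)`,
be `≤ C(1+log β)/β²` for `2 ≤ β ≤ e^{a/U}`, eventually in `L`. This file proves that, modulo exact
finite-dimensional thermodynamics already in the tree and the PROVED free heat chord
(`stub_freeLinearThermalLaw`), the stub is EQUIVALENT to the interacting ENTROPY-DENSITY law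
`S_L(β) ≤ C(1+log β)L²/β` (von Neumann entropy of the torus Gibbs state, `Matrix.gibbsEntropy`):

* `stub_thermalCorrection_of_entropyDensityLaw` (registered sub-goal) — entropy law on
  `[1, e^{a/U}]` ⇒ the stub with constant `2C`: the interacting chord is `≤ S_U(β/2)/(βL²)`
  (`pressure_sub_pressure_le_gibbsEntropy`) and the free chord is `≥ 0`
  (`log_partitionFn_div_antitone`);
* `entropyDensityLaw_of_stub_thermalCorrection` — the stub ⇒ the entropy law on `[2, e^{a/U}]`
  with constant `C + C₁`: `S_U(β) ≤ 2 log Z_{β/2} − log Z_β` (dyadic entropy sandwich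
  `gibbsEntropy_le_two_mul_log_partitionFn_half_sub`) and `chord_U = stub + chord_0 ≤ (C(1+log β)+C₁)/β²`.

So the stub is the specific-heat sector (`c_V = O(T(1+|log T|))` down to `T = e^{-a/U}`) of a
Benfatto–Giuliani–Mastropietro-type interacting Fermi-liquid expansion at general filling — not in
print; the standing disprover's `StubThresholds` shows its `L`-uniform variants are false (`L₀` must
grow with `β`).

Sources: G. Benfatto, A. Giuliani, V. Mastropietro, Ann. Henri Poincaré 7 (2006) 809, Thm 1.1,
Remark 2 [BenfattoGiulianiMastropietro2006]; O. Bratteli, D. W. Robinson, *Operator Algebras and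
Quantum Statistical Mechanics II* §5.3 (Gibbs variational principle, entropy) [BratteliRobinsonII1997].
-/

noncomputable section

namespace Summit.HubbardSuperconductivity.HubbardSuperconductivity.Theorems

open Matrix Finset Literature.MathematicalPhysics.QuantumLattice Literature.Probability.LatticeModels

/-- **The interacting entropy-density law implies the heat-chord stub** (constant `2C`): the
interacting chord is `≤ S_U(β/2)/(βL²)` (`pressure_sub_pressure_le_gibbsEntropy`) and the free chord
is `≥ 0` (`log_partitionFn_div_antitone`). Registered sub-goal of crux item
stmt-HubbardSuperconductivity-1696. [folklore] -/
theorem stub_thermalCorrection_of_entropyDensityLaw :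
    (∀ μ₁ μ₂ : ℝ, -4 < μ₁ → μ₁ ≤ μ₂ → μ₂ < 0 → ∃ U₀ a C : ℝ, 0 < U₀ ∧ 0 < a ∧ 0 < C ∧ ∀ U : ℝ, 0 < U → U ≤ U₀ → ∀ β : ℝ, 1 ≤ β → β ≤ Real.exp (a / U) → ∀ μ ∈ Set.Icc μ₁ μ₂, ∃ L₀ : ℕ, ∀ (L : ℕ) [NeZero L], L₀ ≤ L → Matrix.gibbsEntropy β (Literature.MathematicalPhysics.QuantumLattice.hubbardTorusWith 2 L 1 U μ) ≤ C * (1 + Real.log β) * (L : ℝ) ^ 2 / β) → (∀ μ₁ μ₂ : ℝ, -4 < μ₁ → μ₁ ≤ μ₂ → μ₂ < 0 → ∃ U₀ a C : ℝ, 0 < U₀ ∧ 0 < a ∧ 0 < C ∧ ∀ U : ℝ, 0 < U → U ≤ U₀ → ∀ β : ℝ, 2 ≤ β → β ≤ Real.exp (a / U) → ∀ μ ∈ Set.Icc μ₁ μ₂, ∃ L₀ : ℕ, ∀ (L : ℕ) [NeZero L], L₀ ≤ L → (Real.log (Matrix.partitionFn (β / 2) (Literature.MathematicalPhysics.QuantumLattice.hubbardTorusWith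 2 L 1 U μ)).re / (β / 2 * (L : ℝ) ^ 2) - Real.log (Matrix.partitionFn β (Literature.MathematicalPhysics.QuantumLattice.hubbardTorusWith 2 L 1 U μ)).re / (β * (L : ℝ) ^ 2)) - (Real.log (Matrix.partitionFn (β / 2) (Literature.MathematicalPhysics.QuantumLattice.hubbardTorusWith 2 L 1 0 μ)).re / (β / 2 * (L : ℝ) ^ 2) - Real.log (Matrix.partitionFn β (Literature.MathematicalPhysics.QuantumLattice.hubbardTorusWith 2 L 1 0 μ)).re / (β * (L : ℝ) ^ 2)) ≤ C * (1 + Real.log β) / β ^ 2) := by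
  intro hS μ₁ μ₂ h4 h12 h0
  obtain ⟨U₀, a, C, hU₀, ha, hC, hmain⟩ := hS μ₁ μ₂ h4 h12 h0
  refine ⟨U₀, a, 2 * C, hU₀, ha, by positivity, ?_⟩
  intro U hU hUle β hβ hβB μ hμ
  have hβ0 : 0 < β := by linarith
  have hb1 : 1 ≤ β / 2 := by linarith
  have hbB : β / 2 ≤ Real.exp (a / U) := by linarith
  obtain ⟨L₀, hL₀⟩ := hmain U hU hUle (β / 2) hb1 hbB μ hμ
  refine ⟨L₀, fun L _ hL => ?_⟩
  have hL2 : (0 : ℝ) < (L : ℝ) ^ 2 := cast_sq_pos_of_neZero L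
  have hHU := isHermitian_hubbardTorusWith (L := L) 1 U μ
  have hH0 := isHermitian_hubbardTorusWith (L := L) 1 0 μ
  -- interacting chord ≤ S_U(β/2)/(β L²)
  have h1 := hHU.pressure_sub_pressure_le_gibbsEntropy hβ0 (half_pos hβ0)
  have hfac : (β - β / 2) / (β * (β / 2)) = 1 / β := by
    field_simp
    ring
  rw [hfac] at h1
  have h1' := div_le_div_of_nonneg_right h1 hL2.le
  rw [sub_div, div_div, div_div] at h1'
  -- free chord ≥ 0
  have h2 := log_partitionFn_div_antitone hH0 (half_pos hβ0) (by linarith : β / 2 ≤ β)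
  have h2' := div_le_div_of_nonneg_right h2 hL2.le
  rw [div_div, div_div] at h2'
  -- the entropy bound at β/2
  have hS' := hL₀ L hL
  have hlog : Real.log (β / 2) ≤ Real.log β := Real.log_le_log (by positivity) (by linarith)
  have hSle : gibbsEntropy (β / 2) (hubbardTorusWith 2 L 1 U μ) ≤
      C * (1 + Real.log β) * (L : ℝ) ^ 2 / (β / 2) := by
    refine hS'.trans ?_
    apply div_le_div_of_nonneg_right _ (by positivity)
    have : 0 ≤ C * (L : ℝ) ^ 2 := by positivity
    nlinarith
  have hSbound : 1 / β * gibbsEntropy (β / 2) (hubbardTorusWith 2 L 1 U μ) / (L : ℝ) ^ 2 ≤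
      2 * C * (1 + Real.log β) / β ^ 2 := by
    calc 1 / β * gibbsEntropy (β / 2) (hubbardTorusWith 2 L 1 U μ) / (L : ℝ) ^ 2
        ≤ 1 / β * (C * (1 + Real.log β) * (L : ℝ) ^ 2 / (β / 2)) / (L : ℝ) ^ 2 := by gcongr
      _ = 2 * C * (1 + Real.log β) / β ^ 2 := by
          have hL0 : (L : ℝ) ≠ 0 := by
            intro h
            rw [h] at hL2
            simp at hL2
          field_simp
  linarith [h1', h2', hSbound]

/-- **Converse: the heat-chord stub implies the interacting entropy-density law** on
`[2, e^{a/U}]` (constant `C + C₁`): `S_U(β) ≤ βL²·chord_U(β)`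
(`gibbsEntropy_le_two_mul_log_partitionFn_half_sub`) and `chord_U = stub + chord_0 ≤ (C(1+log β) + C₁)/β²`
by the proved free heat chord `stub_freeLinearThermalLaw`. [folklore] -/
theorem entropyDensityLaw_of_stub_thermalCorrection :
    (∀ μ₁ μ₂ : ℝ, -4 < μ₁ → μ₁ ≤ μ₂ → μ₂ < 0 → ∃ U₀ a C : ℝ, 0 < U₀ ∧ 0 < a ∧ 0 < C ∧ ∀ U : ℝ, 0 < U → U ≤ U₀ → ∀ β : ℝ, 2 ≤ β → β ≤ Real.exp (a / U) → ∀ μ ∈ Set.Icc μ₁ μ₂, ∃ L₀ : ℕ, ∀ (L : ℕ) [NeZero L], L₀ ≤ L → (Real.log (Matrix.partitionFn (β / 2) (Literature.MathematicalPhysics.QuantumLattice.hubbardTorusWith 2 L 1 U μ)).re / (β / 2 * (L : ℝ) ^ 2) - Real.log (Matrix.partitionFn β (Literature.MathematicalPhysics.QuantumLattice.hubbardTorusWith 2 L 1 U μ)).re / (β * (L : ℝ) ^ 2)) - (Real.log (Matrix.partitionFn (β / 2) (Literature.MathematicalPhysics.QuantumLattice.hubbardTorusWith 2 L 1 0 μ)).re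 / (β / 2 * (L : ℝ) ^ 2) - Real.log (Matrix.partitionFn β (Literature.MathematicalPhysics.QuantumLattice.hubbardTorusWith 2 L 1 0 μ)).re / (β * (L : ℝ) ^ 2)) ≤ C * (1 + Real.log β) / β ^ 2) →
    (∀ μ₁ μ₂ : ℝ, -4 < μ₁ → μ₁ ≤ μ₂ → μ₂ < 0 → ∃ U₀ a C : ℝ, 0 < U₀ ∧ 0 < a ∧ 0 < C ∧ ∀ U : ℝ, 0 < U → U ≤ U₀ → ∀ β : ℝ, 2 ≤ β → β ≤ Real.exp (a / U) → ∀ μ ∈ Set.Icc μ₁ μ₂, ∃ L₀ : ℕ, ∀ (L : ℕ) [NeZero L], L₀ ≤ L → Matrix.gibbsEntropy β (Literature.MathematicalPhysics.QuantumLattice.hubbardTorusWith 2 L 1 U μ) ≤ C * (1 + Real.log β) * (L : ℝ) ^ 2 / β) := by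
  intro hT μ₁ μ₂ h4 h12 h0
  obtain ⟨U₀, a, C, hU₀, ha, hC, hmain⟩ := hT μ₁ μ₂ h4 h12 h0
  obtain ⟨C₁, hC₁, hfree⟩ := stub_freeLinearThermalLaw μ₁ μ₂ h4 h12 h0
  refine ⟨U₀, a, C + C₁, hU₀, ha, by positivity, ?_⟩
  intro U hU hUle β hβ hβB μ hμ
  have hβ0 : 0 < β := by linarith
  have hβ1 : 1 ≤ β := by linarith
  obtain ⟨L₁, hL₁⟩ := hmain U hU hUle β hβ hβB μ hμ
  obtain ⟨L₂, hL₂⟩ := hfree β hβ1 μ hμ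
  refine ⟨max L₁ L₂, fun L _ hL => ?_⟩
  have hL2 : (0 : ℝ) < (L : ℝ) ^ 2 := cast_sq_pos_of_neZero L
  have hHU := isHermitian_hubbardTorusWith (L := L) 1 U μ
  have hst := hL₁ L (le_of_max_le_left hL)
  have hfr := hL₂ L (le_of_max_le_right hL) 0 (by rw [abs_zero]; positivity)
  simp only [dWaveSourceTorus_zero] at hfr
  -- S_U(β) ≤ 2 log Z_{β/2} - log Z_β
  have hsand := hHU.gibbsEntropy_le_two_mul_log_partitionFn_half_sub hβ0
  set AU := Real.log (partitionFn (β / 2) (hubbardTorusWith 2 L 1 U μ)).re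
  set BU := Real.log (partitionFn β (hubbardTorusWith 2 L 1 U μ)).re
  -- chord_U ≤ (C(1+log β) + C₁)/β²
  have hchord : AU / (β / 2 * (L : ℝ) ^ 2) - BU / (β * (L : ℝ) ^ 2) ≤
      (C * (1 + Real.log β) + C₁) / β ^ 2 := by
    rw [add_div]
    linarith
  have hlog0 : 0 ≤ Real.log β := Real.log_nonneg hβ1
  have hid : AU / (β / 2 * (L : ℝ) ^ 2) - BU / (β * (L : ℝ) ^ 2) = (2 * AU - BU) / (β * (L : ℝ) ^ 2) := by
    field_simp
  rw [hid, div_le_iff₀ (by positivity)] at hchord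
  calc gibbsEntropy β (hubbardTorusWith 2 L 1 U μ) ≤ 2 * AU - BU := hsand
    _ ≤ (C * (1 + Real.log β) + C₁) / β ^ 2 * (β * (L : ℝ) ^ 2) := hchord
    _ = (C * (1 + Real.log β) + C₁) * (L : ℝ) ^ 2 / β := by
        field_simp
    _ ≤ (C + C₁) * (1 + Real.log β) * (L : ℝ) ^ 2 / β := by
        apply div_le_div_of_nonneg_right _ hβ0.le
        have : 0 ≤ C₁ * Real.log β * (L : ℝ) ^ 2 := by positivity
        nlinarith

end Summit.HubbardSuperconductivity.HubbardSuperconductivity.Theorems
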